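import Mathlib
import HarnessLib

/-!
# The COARSENING DESCENT of the one-pair datum: the signed pair descends along `colⁿ : 𝔉₂ ↠ Λⁿ` because of (KER), the `pair`/`hcompat` binders
# of `deepHalfSigma_of_relaxed` are CONSTRUCTED by descent along the coarsening `π`, and on the reduced currency the 2-adic count is S3's `(i_D)`/`(nz⁺)`

Route `ResidualThetaTransportAtTwo` (RTT), crux RSL_g `ResidualSignedLambdaLowerCMAtTwo` (stmt-BirchSwinnertonDyer-22608); width seat
`prover-bsd-wall-tp2-p2x-w3` g15 (`--supports 22608 --as helper`, closes nothing). THEOREMS ONLY (no definition, no named fact, no instance, no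
`sorry`); pure module algebra, Mathlib only. Stub plan rev 19 request Q81: card `Ideas/stub-cmlambdalower-k4-g15.md`, sketch
`Cruxes/ResidualThetaCountLowerPureAtTwo/Sketch_sidea_k4_g15.lean` §B (B1–B12 + the coordinate kernel B6/B7 + A6 `noZeroSMulDivisors_addMonoidHom`)
and §C (C1–C5) transcribed VERBATIM minus the `Cruxes` namespace (credit: stub-ideation k4 g15). NOT transcribed: §A (A1–A5″, the conditional
no-go `not_deepHalf_functionalModel` / `hπker_necessary*` — documentation of trap T46, stays in the sketch).

WHAT IT SERVES (rev 18/19 §3 item 4, the ASSEMBLY `onePairSupply_of_split`, and `CharIdealLambda.deepHalfSigma_of_relaxed`'s coarsening binders):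
* §1 (B1–B5, additive-map forms matching S2's (KER)/(LIN) clauses literally): an additive `p` killing `ker q` of an ONTO `q` factors `p = pbar ∘ q`
  (`exists_descend_of_surjective`), uniquely (`descend_unique`), and (LIN)/(EH_Z)/(ORTH) descend (`descend_lin`, `descend_EH`, `descend_orth`);
  A6 `noZeroSMulDivisors_addMonoidHom` (`𝔉₂ = (X →+ ℤ_p)` is `ℤ_p`-torsion-free).
* §2 (B6/B7): S2's coordinatewise `t ↦ (col (t ∘ single i))_i` — its kernel is the (KER) antecedent (`coordCol_apply_eq_zero_iff`) and it is onto when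
  `col` is (`exists_coord_preimage`).
* §3 (B8–B12, the TREE's currency): linear descent (`exists_linear_descend`), the `pair`/`hcompat` socket of `deepHalfSigma_of_relaxed` for ANY onto
  coarsening `π` whose kernel pairs to zero with the strict classes (`exists_pair_hcompat`), `ker π ≤ ann(Eplus) × 0` suffices (`hker_of_le_annProd`),
  the two inclusions meet (`ker_inl_iff`), and the forced currency `π := mk_N × id` packaged (`forcedCurrency_package`: onto, `hπker`, `pair`, `hcompat`).
* §4 (C1–C5): `𝔉 ⧸ (L ⊔ ker q) ≃ C ⧸ q(L)`, the third-isomorphism form, `q(span (locd₂ '' Z)) = span (𝒸 '' Z)`, COUNT/FIN transfer to S3's `Q`, and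
  «coarsening only LOWERS the count» (`finrank_baseChange_quotient_coarsen_le`).

References: [Washington1997] §13.2; [Kobayashi2003] Thm. 7.3, §8; [MilneADT2006] I Thm. 4.10. BSD is not proved by any of this; RSL_g (22608) is not proved here.
-/

set_option autoImplicit false
-- the Theorems namespace of this sub repeats the summit name by design (D-0017 nested layout)
set_option linter.dupNamespace false

namespace Summit.BirchSwinnertonDyer.BirchSwinnertonDyer.Theorems.CoarseningDescent

open Function

universe u u' v w x

/-! ## §1 Descent of additive maps along an onto map, and (LIN)/(EH)/(ORTH) -/

section TorsionFree

variable {p : ℕ} [Fact p.Prime]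

/-- **A6.** The 2-adic factor of S2 / p679036, `𝔉₂ = ((Fin n → TP) →+ ℤ_[2])`, is `ℤ₂`-torsion-free (so A2/A4 apply to it verbatim). -/
theorem noZeroSMulDivisors_addMonoidHom (X : Type v) [AddCommGroup X] : NoZeroSMulDivisors ℤ_[p] (X →+ ℤ_[p]) := by
  refine ⟨fun {c f} h ↦ ?_⟩
  by_cases hc : c = 0
  · exact Or.inl hc
  · refine Or.inr (AddMonoidHom.ext fun x ↦ ?_)
    have hx : c * f x = 0 := by simpa using DFunLike.congr_fun h x
    simpa [hc] using hx


end TorsionFree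

/-! ## §B  Repair socket: the signed pair DESCENDS along `colⁿ : 𝔉₂ ↠ Λⁿ` because of (KER) — `pair₂ = pairBar ∘ colⁿ` -/

section Descend

variable {F : Type v} [AddCommGroup F] {C : Type w} [AddCommGroup C] {M : Type x} [AddCommGroup M]

/-- **B1.** An additive map `p` killing the kernel of an ONTO additive map `q` factors through it: `p = pbar ∘ q`.  For S2: `p := pair₂`,
`q := colⁿ` (onto by `SignedColemanImage.colemanPlus_coeff_two` / `hondaPlus_onto_two`), the hypothesis IS the (KER) clause. -/
theorem exists_descend_of_surjective (p : F →+ M) (q : F →+ C) (hq : Surjective q) (hKER : ∀ t, q t = 0 → p t = 0) :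
    ∃ pbar : C →+ M, ∀ t : F, pbar (q t) = p t := by
  have key : ∀ t t' : F, q t = q t' → p t = p t' := fun t t' h ↦ by
    rw [← sub_eq_zero, ← map_sub]
    exact hKER _ (by rw [map_sub, h, sub_self])
  refine ⟨{ toFun := fun c ↦ p (surjInv hq c), map_zero' := ?_, map_add' := fun c c' ↦ ?_ }, fun t ↦ ?_⟩
  · rw [← map_zero p]
    exact key _ _ (by rw [surjInv_eq hq, map_zero])
  · rw [← map_add]
    exact key _ _ (by rw [map_add, surjInv_eq hq, surjInv_eq hq, surjInv_eq hq])
  · exact key _ _ (surjInv_eq hq (q t))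

/-- **B2.** The descended map is unique. -/
theorem descend_unique (q : F →+ C) (hq : Surjective q) (p₁ p₂ : C →+ M) (h : ∀ t : F, p₁ (q t) = p₂ (q t)) : p₁ = p₂ := by
  ext c
  obtain ⟨t, rfl⟩ := hq c
  exact h t

/-- **B3 ((LIN) descends).** If `p (c • t) = φ c (p t)` (S2 (LIN): `pair₂ (c • t) s = pair₂ t (ι c • s)`, i.e. `φ c` = precomposition with
`ι c • ·`) and `q` commutes with the scalars, then `pbar (c • y) = φ c (pbar y)` — the N5 binder `hpair` for the descended pair. -/
theorem descend_lin {R : Type u} [SMul R F] [SMul R C] (p : F →+ M) (q : F →+ C) (hq : Surjective q)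
    (pbar : C →+ M) (hbar : ∀ t : F, pbar (q t) = p t) (φ : R → M → M)
    (hLIN : ∀ (c : R) (t : F), p (c • t) = φ c (p t)) (hq_smul : ∀ (c : R) (t : F), q (c • t) = c • q t)
    (c : R) (y : C) : pbar (c • y) = φ c (pbar y) := by
  obtain ⟨t, rfl⟩ := hq y
  rw [← hq_smul, hbar, hbar, hLIN]

/-- **B4 ((EH_Z) descends).** `p (locd₂ x) = 0 → pbar ((q ∘ locd₂) x) = 0` — with `q ∘ locd₂ = 𝒸` this is the (EH_Z) binder in the reduced currency. -/
theorem descend_EH {H : Type u} [AddCommGroup H] (p : F →+ M) (q : F →+ C) (pbar : C →+ M)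
    (hbar : ∀ t : F, pbar (q t) = p t) (locd₂ : H →+ F) (x : H) (hEH : p (locd₂ x) = 0) :
    pbar ((q.comp locd₂) x) = 0 := by
  simpa [hbar] using hEH

/-- **B5 (ORTH descends).** `(∀ t, p t s = 0) → ∀ y, pbar y s = 0` for character-valued pairs (`M = Sel → ℚ/ℤ`-like function types). -/
theorem descend_orth {Sel V : Type*} [AddCommGroup V] (p : F →+ (Sel → V)) (q : F →+ C) (hq : Surjective q)
    (pbar : C →+ (Sel → V)) (hbar : ∀ t : F, pbar (q t) = p t) (s : Sel) (horth : ∀ t : F, p t s = 0) (y : C) :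
    pbar y s = 0 := by
  obtain ⟨t, rfl⟩ := hq y
  rw [hbar]
  exact horth t

end Descend

section CoordinateKernel

variable {p : ℕ} [Fact p.Prime] {X : Type v} [AddCommGroup X] {C : Type w} [AddCommGroup C]

/-- S2's coordinatewise map `t ↦ (col (t ∘ single i))_i` (`𝒸 = colⁿ ∘ locd₂` of V2A §2) as ONE additive map `𝔉₂ → Cⁿ`. Its kernel is literally
the (KER) antecedent `∀ i, col (t ∘ single i) = 0` (B6) and it is onto when `col` is (B7) — so B1 applies with `q := coordCol`. -/
theorem coordCol_apply_eq_zero_iff {n : ℕ} (col : (X →+ ℤ_[p]) →+ C) (t : (Fin n → X) →+ ℤ_[p]) :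
    (fun i : Fin n ↦ col (t.comp (AddMonoidHom.single (fun _ : Fin n ↦ X) i))) = 0 ↔
      ∀ i, col (t.comp (AddMonoidHom.single (fun _ : Fin n ↦ X) i)) = 0 :=
  funext_iff

/-- **B7.** `colⁿ` is onto when `col` is: given `(c_i)`, take `t := Σ_i t_i ∘ proj_i` with `col t_i = c_i`. -/
theorem exists_coord_preimage {n : ℕ} (col : (X →+ ℤ_[p]) →+ C) (hcol : Surjective col) (c : Fin n → C) :
    ∃ t : (Fin n → X) →+ ℤ_[p], ∀ i, col (t.comp (AddMonoidHom.single (fun _ : Fin n ↦ X) i)) = c i := by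
  classical
  choose s hs using fun i ↦ hcol (c i)
  refine ⟨∑ i, (s i).comp (Pi.evalAddMonoidHom (fun _ : Fin n ↦ X) i), fun i ↦ ?_⟩
  have hcomp : (∑ j, (s j).comp (Pi.evalAddMonoidHom (fun _ : Fin n ↦ X) j)).comp
      (AddMonoidHom.single (fun _ : Fin n ↦ X) i) = s i := by
    ext x
    simp only [AddMonoidHom.coe_comp, AddMonoidHom.finsetSum_apply, Function.comp_apply,
      Pi.evalAddMonoidHom_apply, AddMonoidHom.single_apply]
    rw [Finset.sum_eq_single i]
    · simp
    · intro j _ hj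
      simp [Pi.single_eq_of_ne hj]
    · simp
  rw [hcomp, hs]

end CoordinateKernel

section DescendTree

/-! ### §B in the TREE's currency: the `pair`/`hcompat` binders of `deepHalfSigma_of_relaxed` CONSTRUCTED by descent along `π`. -/

variable {A : Type u} [CommRing A]

/-- **B8 (linear descent).** `ker q ≤ ker p`, `q` onto ⟹ `p = pbar ∘ q`. -/
theorem exists_linear_descend {F C M : Type v} [AddCommGroup F] [Module A F] [AddCommGroup C] [Module A C]
    [AddCommGroup M] [Module A M] (p : F →ₗ[A] M) (q : F →ₗ[A] C) (hq : Surjective q)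
    (hKER : LinearMap.ker q ≤ LinearMap.ker p) : ∃ pbar : C →ₗ[A] M, ∀ t : F, pbar (q t) = p t := by
  refine ⟨(LinearMap.ker q).liftQ p hKER ∘ₗ (q.quotKerEquivOfSurjective hq).symm.toLinearMap, fun t ↦ ?_⟩
  have h : (q.quotKerEquivOfSurjective hq).symm (q t) = Submodule.Quotient.mk t := by
    rw [LinearEquiv.symm_apply_eq]
    rfl
  simp [h]

variable {P₀ PS D₂ DS P SelRel : Type v}
  [AddCommGroup P₀] [Module A P₀] [AddCommGroup PS] [Module A PS] [AddCommGroup D₂] [Module A D₂]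
  [AddCommGroup DS] [Module A DS] [AddCommGroup P] [Module A P] [AddCommGroup SelRel] [Module A SelRel]

/-- **B9 (the `pair`/`hcompat` socket).** For ANY onto coarsening `π` whose kernel pairs to zero with the strict classes, the binder
`pair : P →ₗ[A] CharacterModule Sg` of `deepHalfSigma_of_relaxed` EXISTS with `hcompat` — it is the descent of the relaxed local character
`(t₂,t_S) ↦ (s ↦ ⟨t₂, loc₂ s⟩₂ + ⟨t_S, loc_S s⟩_S)` restricted to `Sg`.  (With `π = colⁿ × id` and S2's VAL this is `pairBar ⊕ pins`.) -/
theorem exists_pair_hcompat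
    (c₂ : P₀ →ₗ[A] CharacterModule D₂) (cS : PS →ₗ[A] CharacterModule DS)
    (loc₂ : SelRel →ₗ[A] D₂) (locS : SelRel →ₗ[A] DS) (Sg : Submodule A SelRel)
    (π : (P₀ × PS) →ₗ[A] P) (hπ : Surjective π)
    (hker : ∀ t : P₀ × PS, π t = 0 → ∀ s : Sg, c₂ t.1 (loc₂ s) + cS t.2 (locS s) = 0) :
    ∃ pair : P →ₗ[A] CharacterModule Sg,
      ∀ (t : P₀ × PS) (s : Sg), pair (π t) s = c₂ t.1 (loc₂ s) + cS t.2 (locS s) := by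
  let toChar : (P₀ × PS) →ₗ[A] CharacterModule (D₂ × DS) :=
    CharacterModule.dual (LinearMap.fst A D₂ DS) ∘ₗ c₂ ∘ₗ LinearMap.fst A P₀ PS +
      CharacterModule.dual (LinearMap.snd A D₂ DS) ∘ₗ cS ∘ₗ LinearMap.snd A P₀ PS
  have htoChar : ∀ (t : P₀ × PS) (x : D₂ × DS), toChar t x = c₂ t.1 x.1 + cS t.2 x.2 := fun _ _ ↦ rfl
  let pair' : (P₀ × PS) →ₗ[A] CharacterModule Sg := CharacterModule.dual ((loc₂.prod locS) ∘ₗ Sg.subtype) ∘ₗ toChar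
  have hpair' : ∀ (t : P₀ × PS) (s : Sg), pair' t s = c₂ t.1 (loc₂ s) + cS t.2 (locS s) := fun _ _ ↦ rfl
  have hle : LinearMap.ker π ≤ LinearMap.ker pair' := by
    intro t ht
    rw [LinearMap.mem_ker] at ht ⊢
    ext s
    rw [hpair']
    exact hker t ht s
  obtain ⟨pbar, hbar⟩ := exists_linear_descend pair' π hπ hle
  exact ⟨pbar, fun t s ↦ by rw [hbar, hpair']⟩

/-- **B10 (when the forced kernel is admissible).** If `ker π ≤ ann(Eplus) × 0` (the CONVERSE inclusion to `hπker`) and the strict classes are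
plus at 2 (`hSg`), the hypothesis `hker` of B9 holds.  With A5′: `ker π = ann(Eplus) × 0` is admissible AND minimal — the entry currency is
`P = P₀ ⧸ ann(Eplus) × P_S` (`≅ Λⁿ × P_S` by `colemanPlus_coeff_two`), forced, not chosen. -/
theorem hker_of_le_annProd
    (c₂ : P₀ →ₗ[A] CharacterModule D₂) (cS : PS →ₗ[A] CharacterModule DS)
    (loc₂ : SelRel →ₗ[A] D₂) (locS : SelRel →ₗ[A] DS) (Eplus : Submodule A D₂)
    (Sg : Submodule A SelRel) (hSg : ∀ s, s ∈ Sg ↔ loc₂ s ∈ Eplus)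
    (π : (P₀ × PS) →ₗ[A] P)
    (hπle : ∀ t : P₀ × PS, π t = 0 → t.2 = 0 ∧ ∀ e ∈ Eplus, c₂ t.1 e = 0) :
    ∀ t : P₀ × PS, π t = 0 → ∀ s : Sg, c₂ t.1 (loc₂ s) + cS t.2 (locS s) = 0 := by
  intro t ht s
  obtain ⟨h2, h1⟩ := hπle t ht
  rw [h2, map_zero, h1 _ ((hSg s).1 s.2), zero_add]
  rfl

/-- **B11 (the two inclusions meet).** Under `hπker` (tree, sufficient) AND `hπle` (B10), `ker π` restricted to the 2-adic factor IS `ann(Eplus)`: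
`π (h₂, 0) = 0 ↔ ∀ e ∈ Eplus, c₂ h₂ e = 0`. -/
theorem ker_inl_iff
    (c₂ : P₀ →ₗ[A] CharacterModule D₂) (Eplus : Submodule A D₂) (π : (P₀ × PS) →ₗ[A] P)
    (hπker : ∀ h₂ : P₀, (∀ e ∈ Eplus, c₂ h₂ e = 0) → π (h₂, 0) = 0)
    (hπle : ∀ t : P₀ × PS, π t = 0 → t.2 = 0 ∧ ∀ e ∈ Eplus, c₂ t.1 e = 0) (h₂ : P₀) :
    π (h₂, 0) = 0 ↔ ∀ e ∈ Eplus, c₂ h₂ e = 0 :=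
  ⟨fun h ↦ (hπle _ h).2, hπker h₂⟩

/-- **B12 (the forced currency, packaged).** With `N = ann(Eplus) ≤ P₀` and `π := mk_N × id : P₀ × P_S ↠ (P₀ ⧸ N) × P_S` (the cut of
`SKELETON-V2-CUT-g16` l. 55), ALL the coarsening binders of `deepHalfSigma_of_relaxed` are discharged: `π` onto, `hπker`, and the `pair` with
`hcompat` (by B9/B10).  What remains for the assembly is only `hDHrel` (place cut, p684598) and the N5 counts — on `(P₀ ⧸ N) × P_S ≅ Λⁿ × P_S`. -/
theorem forcedCurrency_package
    (c₂ : P₀ →ₗ[A] CharacterModule D₂) (cS : PS →ₗ[A] CharacterModule DS)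
    (loc₂ : SelRel →ₗ[A] D₂) (locS : SelRel →ₗ[A] DS) (Eplus : Submodule A D₂)
    (Sg : Submodule A SelRel) (hSg : ∀ s, s ∈ Sg ↔ loc₂ s ∈ Eplus)
    (N : Submodule A P₀) (hN : ∀ h₂, h₂ ∈ N ↔ ∀ e ∈ Eplus, c₂ h₂ e = 0) :
    Surjective (N.mkQ.prodMap (LinearMap.id : PS →ₗ[A] PS)) ∧
    (∀ h₂ : P₀, (∀ e ∈ Eplus, c₂ h₂ e = 0) → N.mkQ.prodMap (LinearMap.id : PS →ₗ[A] PS) (h₂, 0) = 0) ∧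
    ∃ pair : ((P₀ ⧸ N) × PS) →ₗ[A] CharacterModule Sg,
      ∀ (t : P₀ × PS) (s : Sg), pair (N.mkQ.prodMap LinearMap.id t) s = c₂ t.1 (loc₂ s) + cS t.2 (locS s) := by
  have hπ : Surjective (N.mkQ.prodMap (LinearMap.id : PS →ₗ[A] PS)) := by
    rintro ⟨y, u⟩
    obtain ⟨t, rfl⟩ := Submodule.mkQ_surjective N y
    exact ⟨(t, u), rfl⟩
  refine ⟨hπ, fun h₂ hh₂ ↦ ?_, ?_⟩
  · rw [LinearMap.prodMap_apply, LinearMap.id_apply, Prod.mk_eq_zero]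
    exact ⟨(Submodule.Quotient.mk_eq_zero N).2 ((hN h₂).2 hh₂), rfl⟩
  · refine exists_pair_hcompat c₂ cS loc₂ locS Sg _ hπ
      (hker_of_le_annProd c₂ cS loc₂ locS Eplus Sg hSg _ fun t ht ↦ ?_)
    rw [LinearMap.prodMap_apply, LinearMap.id_apply, Prod.mk_eq_zero] at ht
    exact ⟨ht.2, (hN t.1).1 ((Submodule.Quotient.mk_eq_zero N).1 ht.1)⟩

end DescendTree

/-! ## §C  On the reduced currency the 2-adic count IS S3's `(i_D)`/`(nz⁺)`; coarsening further only lowers the count -/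

section Transfer

variable {R : Type u} [CommRing R] {F : Type v} [AddCommGroup F] [Module R F] {C : Type v} [AddCommGroup C] [Module R C]

/-- **C1.** `𝔉 ⧸ (L ⊔ ker q) ≃ C ⧸ q(L)` for `q` onto. -/
theorem nonempty_quotSupKer_equiv (q : F →ₗ[R] C) (hq : Surjective q) (L : Submodule R F) :
    Nonempty ((F ⧸ (L ⊔ LinearMap.ker q)) ≃ₗ[R] (C ⧸ L.map q)) := by
  have hsurj : Surjective ((L.map q).mkQ ∘ₗ q) := (Submodule.mkQ_surjective _).comp hq
  have hker : LinearMap.ker ((L.map q).mkQ ∘ₗ q) = L ⊔ LinearMap.ker q := by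
    rw [LinearMap.ker_comp, Submodule.ker_mkQ, Submodule.comap_map_eq]
  exact ⟨(Submodule.quotEquivOfEq _ _ hker.symm).trans (LinearMap.quotKerEquivOfSurjective _ hsurj)⟩

/-- **C2.** With `K := ker q`: `(𝔉 ⧸ K) ⧸ L̄ ≃ C ⧸ q(L)`, `L̄ := L.map mk` (third isomorphism theorem) — for an entry typed as `P₂ := 𝔉₂ ⧸ ann((⨆E⁺)ⁿ)`
(SKELETON-V2-CUT l. 55) rather than `P₂ := Λⁿ`: same numbers, since `ann((⨆E⁺)ⁿ) = ker colⁿ` (`colemanPlus_coeff_two`). -/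
theorem nonempty_reduced_equiv (q : F →ₗ[R] C) (hq : Surjective q) (L : Submodule R F) :
    Nonempty ((((F ⧸ LinearMap.ker q) ⧸ L.map (LinearMap.ker q).mkQ)) ≃ₗ[R] (C ⧸ L.map q)) := by
  obtain ⟨e₂⟩ := nonempty_quotSupKer_equiv q hq L
  exact ⟨(Submodule.quotientQuotientEquivQuotientSup (LinearMap.ker q) L).trans
    ((Submodule.quotEquivOfEq _ _ (sup_comm _ _)).trans e₂)⟩

/-- **C3.** `q(span (locd₂ '' Z)) = span (𝒸 '' Z)` with `𝒸 = q ∘ locd₂` — the reduced 2-adic sublattice IS S3's `span (𝒸 '' Λ_𝒪 z)`. -/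
theorem map_span_image {H : Type w} (q : F →ₗ[R] C) (locd₂ : H → F) (Z : Set H) :
    (Submodule.span R (locd₂ '' Z)).map q = Submodule.span R ((fun x ↦ q (locd₂ x)) '' Z) := by
  rw [Submodule.map_span, Set.image_image]

variable (K' : Type w) [Field K'] [Algebra R K']

open scoped TensorProduct

/-- Finiteness after base change to `K'` transfers along an `R`-linear equivalence (plumbing for C4). -/
theorem finite_baseChange_iff_of_equiv {X Y : Type v} [AddCommGroup X] [Module R X] [AddCommGroup Y] [Module R Y]
    (e : X ≃ₗ[R] Y) : Module.Finite K' (K' ⊗[R] X) ↔ Module.Finite K' (K' ⊗[R] Y) :=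
  ⟨fun _ ↦ Module.Finite.equiv (LinearEquiv.baseChange R K' X Y e),
   fun _ ↦ Module.Finite.equiv (LinearEquiv.baseChange R K' X Y e).symm⟩

/-- The `K'`-dimension after base change transfers along an `R`-linear equivalence (plumbing for C4). -/
theorem finrank_baseChange_eq_of_equiv {X Y : Type v} [AddCommGroup X] [Module R X] [AddCommGroup Y] [Module R Y]
    (e : X ≃ₗ[R] Y) : Module.finrank K' (K' ⊗[R] X) = Module.finrank K' (K' ⊗[R] Y) :=
  LinearEquiv.finrank_eq (LinearEquiv.baseChange R K' X Y e)

/-- **C4 (COUNT/FIN transfer).** The reduced 2-adic quotient and S3's `Q = C ⧸ q(L)` have the same `K'`-dimension after base change and are finite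
together: `(nz⁺)` IS `hfinP`'s 2-adic share and `(i_D)` IS the 2-adic COUNT. -/
theorem finrank_reduced_eq (q : F →ₗ[R] C) (hq : Surjective q) (L : Submodule R F) :
    Module.finrank K' (K' ⊗[R] ((F ⧸ LinearMap.ker q) ⧸ L.map (LinearMap.ker q).mkQ)) =
      Module.finrank K' (K' ⊗[R] (C ⧸ L.map q)) ∧
    (Module.Finite K' (K' ⊗[R] ((F ⧸ LinearMap.ker q) ⧸ L.map (LinearMap.ker q).mkQ)) ↔
      Module.Finite K' (K' ⊗[R] (C ⧸ L.map q))) := by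
  obtain ⟨e⟩ := nonempty_reduced_equiv q hq L
  exact ⟨finrank_baseChange_eq_of_equiv K' e, finite_baseChange_iff_of_equiv K' e⟩

/-- **C5 (optimality: coarsening only LOWERS the count).** For any onto `σ : P → P̄` and sublattice `L ≤ P`:
`λ(P̄ ⧸ σ L) ≤ λ(P ⧸ L)` (and finiteness transfers).  With A5: `ker π = ker colⁿ × 0` is the unique optimal admissible currency —
finer is refutable, coarser is weaker.  (The case `σ = id`, `L ≤ L'` is k1-g5 M1 `finrank_baseChange_quotient_anti`.) -/
theorem finrank_baseChange_quotient_coarsen_le {P Pb : Type v} [AddCommGroup P] [Module R P] [AddCommGroup Pb] [Module R Pb]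
    (σ : P →ₗ[R] Pb) (hσ : Surjective σ) (L : Submodule R P) [Module.Finite K' (K' ⊗[R] (P ⧸ L))] :
    Module.Finite K' (K' ⊗[R] (Pb ⧸ L.map σ)) ∧
      Module.finrank K' (K' ⊗[R] (Pb ⧸ L.map σ)) ≤ Module.finrank K' (K' ⊗[R] (P ⧸ L)) := by
  set τ : (P ⧸ L) →ₗ[R] (Pb ⧸ L.map σ) := L.mapQ (L.map σ) σ (fun x hx ↦ Submodule.mem_map_of_mem hx) with hτ
  have hτs : Surjective τ := by
    intro y
    induction y using Submodule.Quotient.induction_on with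
    | H b =>
      obtain ⟨a, rfl⟩ := hσ b
      exact ⟨Submodule.Quotient.mk a, by simp [hτ]⟩
  have hs : Surjective (τ.baseChange K') := by
    rw [LinearMap.baseChange_eq_ltensor]
    exact LinearMap.lTensor_surjective K' hτs
  refine ⟨Module.Finite.of_surjective _ hs, ?_⟩
  calc Module.finrank K' (K' ⊗[R] (Pb ⧸ L.map σ))
      = Module.finrank K' (LinearMap.range (τ.baseChange K')) := by
        rw [LinearMap.range_eq_top.mpr hs, finrank_top]
    _ ≤ Module.finrank K' (K' ⊗[R] (P ⧸ L)) := LinearMap.finrank_range_le _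

end Transfer

end Summit.BirchSwinnertonDyer.BirchSwinnertonDyer.Theorems.CoarseningDescent
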